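import Summits.QuantumFields.GaugeBoot.RightShiftRows
import HarnessLib

/-!
# Left loop equations imply right loop equations: `U(N)` and `SU(N)` (gauge-boot, L1 supplement)

HONEST FRAMING (cell `pub-gaugeboot`, page 1 of every file): the venture produces certified bounds
on lattice expectations at stated coupling, gauge group, dimension and torus size; NOT a mass gap,
NOT a continuum limit, NOT a string tension; NOT Yang–Mills-summit-bearing (barriers
`FixedCouplingUltralocality`, `PerturbativeInvisibility`). Structural; it certifies no number.

## Content

`RightShiftRows.lean` derives the RIGHT one-link loop equations from the LEFT ones for any
Schwinger–Dyson functional, given finitely many directions reproducing the conjugated generators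
with divergence-free linear coordinates. Here the hypotheses are discharged for the unitary groups
with the MATRIX-UNIT directions `unitA a b = E_ab - E_ba`, `unitB a b = i(E_ab + E_ba)` (for `SU(N)`
the diagonal ones corrected to traceless `unitB'`), coordinates `½ Re Y_ab`, `½ Im Y_ab`:
`skewAdjoint_decomp` / `skewAdjoint_traceless_decomp` (reproduction), `coefRe_comm_unitA`,
`coefIm_comm_unitB(')` (DIVERGENCE FREENESS: `[unitA a b, Y]_ab = Y_bb - Y_aa` has no real part and
`[unitB a b, Y]_ab = i(Y_bb - Y_aa)` no imaginary part for skew-Hermitian `Y` — termwise, no trace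
of `ad` needed); ★★★ `IsSDFunctional.isRightSDFunctional_uN` / `_suN` — for `U(N)` / `SU(N)` link
variables on any index set, polynomial local actions, any `β`: the left loop equations along all
`e^{tX}` imply the right ones; ★★★ `isRightSDFunctional_wilson_uN` / `_suN` (torus Wilson action).
Consequence (sequel): the bootstrap rows are covariant under orientation-REVERSING lattice
symmetries.

References: M. Creutz, *Quarks, gluons and lattices* (1983) Ch. 8; folklore.
-/

noncomputable section

open Filter Topology NormedSpace
open scoped Matrix ComplexConjugate
open Literature.MathematicalPhysics.QuantumFieldTheory (LatticeRep)

namespace Summit.QuantumFields.GaugeBoot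

/-! ## Matrix units of `𝔲(N)` and `𝔰𝔲(N)` -/

section MatrixUnits

variable {N : ℕ}

/-- The antisymmetric matrix unit `E_ab - E_ba ∈ 𝔲(N)`. [folklore] -/
def unitA (a b : Fin N) : Matrix (Fin N) (Fin N) ℂ := Matrix.single a b 1 - Matrix.single b a 1

/-- The symmetric matrix unit `i(E_ab + E_ba) ∈ 𝔲(N)`. [folklore] -/
def unitB (a b : Fin N) : Matrix (Fin N) (Fin N) ℂ := Complex.I • (Matrix.single a b 1 + Matrix.single b a 1)

/-- The traceless symmetric unit `i(E_ab + E_ba) - δ_ab (2i/N)·1 ∈ 𝔰𝔲(N)`. [folklore] -/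
def unitB' (a b : Fin N) : Matrix (Fin N) (Fin N) ℂ :=
  unitB a b - if a = b then ((2 : ℂ) * Complex.I / N) • (1 : Matrix (Fin N) (Fin N) ℂ) else 0

/-- Entries of `unitA`. -/
theorem unitA_apply (a b c d : Fin N) :
    unitA a b c d = (if a = c ∧ b = d then 1 else 0) - (if b = c ∧ a = d then 1 else 0) := by
  simp [unitA, Matrix.single_apply]
/-- Entries of `unitB`. -/
theorem unitB_apply (a b c d : Fin N) :
    unitB a b c d = Complex.I * ((if a = c ∧ b = d then 1 else 0) + (if b = c ∧ a = d then 1 else 0)) := by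
  simp [unitB, Matrix.single_apply]

/-- `unitA` is skew-Hermitian. -/
theorem star_unitA (a b : Fin N) : star (unitA a b) = -unitA a b := by
  rw [unitA, Matrix.star_eq_conjTranspose, Matrix.conjTranspose_sub, Matrix.conjTranspose_single,
    Matrix.conjTranspose_single, star_one, neg_sub]

/-- `unitB` is skew-Hermitian. -/
theorem star_unitB (a b : Fin N) : star (unitB a b) = -unitB a b := by
  rw [unitB, Matrix.star_eq_conjTranspose, Matrix.conjTranspose_smul, Matrix.conjTranspose_add,
    Matrix.conjTranspose_single, Matrix.conjTranspose_single, star_one, Complex.star_def, Complex.conj_I,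
    neg_smul, add_comm]

/-- `unitB'` is skew-Hermitian. -/
theorem star_unitB' (a b : Fin N) : star (unitB' a b) = -unitB' a b := by
  unfold unitB'
  split_ifs with h
  · have hc : star (((2 : ℂ) * Complex.I / N) • (1 : Matrix (Fin N) (Fin N) ℂ)) =
        -(((2 : ℂ) * Complex.I / N) • (1 : Matrix (Fin N) (Fin N) ℂ)) := by
      rw [Matrix.star_eq_conjTranspose, Matrix.conjTranspose_smul, Matrix.conjTranspose_one, ← neg_smul]
      congr 1
      rw [Complex.star_def, map_div₀, map_mul, Complex.conj_I, map_natCast, map_ofNat]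
      ring
    rw [star_sub, star_unitB, hc]
    abel
  · simpa using star_unitB a b

/-- `unitA` is traceless. -/
theorem trace_unitA (a b : Fin N) : (unitA a b).trace = 0 := by
  by_cases h : a = b
  · subst h; simp [unitA]
  · rw [unitA, Matrix.trace_sub, Matrix.trace_single_eq_of_ne _ _ _ h, Matrix.trace_single_eq_of_ne _ _ _ (Ne.symm h),
      sub_zero]

/-- `unitB'` is traceless. -/
theorem trace_unitB' (a b : Fin N) : (unitB' a b).trace = 0 := by
  have hN : (N : ℂ) ≠ 0 := by
    have : N ≠ 0 := Fin.pos_iff_nonempty.2 ⟨a⟩ |>.ne'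
    exact_mod_cast this
  unfold unitB' unitB
  split_ifs with h
  · subst h
    rw [Matrix.trace_sub, Matrix.trace_smul, Matrix.trace_add, Matrix.trace_single_eq_same, Matrix.trace_smul,
      Matrix.trace_one, Fintype.card_fin]
    simp only [smul_eq_mul]
    field_simp
    ring
  · rw [sub_zero, Matrix.trace_smul, Matrix.trace_add, Matrix.trace_single_eq_of_ne _ _ _ h,
      Matrix.trace_single_eq_of_ne _ _ _ (Ne.symm h), add_zero, smul_zero]

/-- The coordinate `Y ↦ ½ Re Y_ab`. [folklore] -/
def coefRe (a b : Fin N) : Matrix (Fin N) (Fin N) ℂ →ₗ[ℝ] ℝ :=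
  (1 / 2 : ℝ) • (Complex.reLm ∘ₗ (Matrix.entryLinearMap ℂ ℂ a b).restrictScalars ℝ)

/-- The coordinate `Y ↦ ½ Im Y_ab`. [folklore] -/
def coefIm (a b : Fin N) : Matrix (Fin N) (Fin N) ℂ →ₗ[ℝ] ℝ :=
  (1 / 2 : ℝ) • (Complex.imLm ∘ₗ (Matrix.entryLinearMap ℂ ℂ a b).restrictScalars ℝ)

/-- `coefRe` evaluated. -/
@[simp] theorem coefRe_apply (a b : Fin N) (Y : Matrix (Fin N) (Fin N) ℂ) : coefRe a b Y = (Y a b).re / 2 := by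
  simp [coefRe]; ring
/-- `coefIm` evaluated. -/
@[simp] theorem coefIm_apply (a b : Fin N) (Y : Matrix (Fin N) (Fin N) ℂ) : coefIm a b Y = (Y a b).im / 2 := by
  simp [coefIm]; ring

/-- Double Kronecker sums. -/
theorem sum_sum_ite_eq_and (G : Fin N → Fin N → ℂ) (c d : Fin N) :
    ∑ a, ∑ b, (if a = c ∧ b = d then G a b else 0) = G c d := by
  rw [Finset.sum_eq_single c (fun a _ hac => by simp [hac]) (by simp)]
  simp
/-- Double Kronecker sums, transposed. -/
theorem sum_sum_ite_eq_and' (G : Fin N → Fin N → ℂ) (c d : Fin N) :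
    ∑ a, ∑ b, (if b = c ∧ a = d then G a b else 0) = G d c := by
  rw [Finset.sum_eq_single d (fun a _ had => by simp [had]) (by simp)]
  simp

/-- Entries of a skew-Hermitian matrix: `Y_dc = -conj Y_cd`. -/
theorem apply_eq_neg_conj_of_star_eq_neg {Y : Matrix (Fin N) (Fin N) ℂ} (hY : star Y = -Y) (c d : Fin N) :
    Y d c = -conj (Y c d) := by
  have h := congrFun (congrFun hY d) c
  rw [Matrix.star_apply, Matrix.neg_apply] at h
  have h' : Y d c = -star (Y c d) := by rw [h, neg_neg]
  simpa [Complex.star_def] using h'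

/-- ★ **Decomposition of a skew-Hermitian matrix in the matrix units**:
`Y = Σ_ab ½Re(Y_ab) (E_ab - E_ba) + ½Im(Y_ab) i(E_ab + E_ba)`. [folklore] -/
theorem skewAdjoint_decomp (Y : Matrix (Fin N) (Fin N) ℂ) (hY : star Y = -Y) :
    Y = ∑ a, ∑ b, (coefRe a b Y • unitA a b + coefIm a b Y • unitB a b) := by
  ext c d
  simp only [Matrix.sum_apply, Matrix.add_apply, Matrix.smul_apply, unitA_apply, unitB_apply, Complex.real_smul,
    mul_sub, mul_add, coefRe_apply, coefIm_apply]
  simp only [mul_ite, mul_one, mul_zero, Finset.sum_add_distrib, Finset.sum_sub_distrib, sum_sum_ite_eq_and,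
    sum_sum_ite_eq_and']
  have h1 := apply_eq_neg_conj_of_star_eq_neg hY c d
  apply Complex.ext
  · simp [h1]; ring
  · simp [h1]

/-- ★ **Decomposition of a traceless skew-Hermitian matrix in the traceless units.** [folklore] -/
theorem skewAdjoint_traceless_decomp (Y : Matrix (Fin N) (Fin N) ℂ) (hY : star Y = -Y) (htr : Y.trace = 0) :
    Y = ∑ a, ∑ b, (coefRe a b Y • unitA a b + coefIm a b Y • unitB' a b) := by
  have hcorr : ∑ a : Fin N, ∑ b : Fin N,
      coefIm a b Y • (if a = b then ((2 : ℂ) * Complex.I / N) • (1 : Matrix (Fin N) (Fin N) ℂ) else 0) = 0 := by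
    have h1 : ∀ a : Fin N, ∑ b : Fin N,
        coefIm a b Y • (if a = b then ((2 : ℂ) * Complex.I / N) • (1 : Matrix (Fin N) (Fin N) ℂ) else 0) =
          ((Y a a).im / 2 : ℝ) • (((2 : ℂ) * Complex.I / N) • (1 : Matrix (Fin N) (Fin N) ℂ)) := fun a => by
      rw [Finset.sum_eq_single a (fun b _ hba => by simp [Ne.symm hba]) (by simp)]
      simp
    simp_rw [h1, ← Finset.sum_smul]
    have h2 : ∑ a : Fin N, ((Y a a).im / 2 : ℝ) = (Y.trace).im / 2 := by
      rw [Matrix.trace, Complex.im_sum, Finset.sum_div]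
      rfl
    rw [h2, htr, Complex.zero_im, zero_div, zero_smul]
  calc Y = ∑ a, ∑ b, (coefRe a b Y • unitA a b + coefIm a b Y • unitB a b) := skewAdjoint_decomp Y hY
    _ = ∑ a, ∑ b, (coefRe a b Y • unitA a b + coefIm a b Y • unitB' a b) +
          ∑ a, ∑ b, coefIm a b Y • (if a = b then ((2 : ℂ) * Complex.I / N) • (1 : Matrix (Fin N) (Fin N) ℂ) else 0) := by
        rw [← Finset.sum_add_distrib]
        refine Finset.sum_congr rfl fun a _ => ?_
        rw [← Finset.sum_add_distrib]
        refine Finset.sum_congr rfl fun b _ => ?_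
        rw [unitB', smul_sub, add_sub_assoc', sub_add_cancel]
    _ = _ := by rw [hcorr, add_zero]

/-- `[unitA a b, Y]_ab = Y_bb - Y_aa`. -/
theorem comm_unitA_apply (Y : Matrix (Fin N) (Fin N) ℂ) (a b : Fin N) :
    (unitA a b * Y - Y * unitA a b) a b = Y b b - Y a a := by
  simp only [unitA, Matrix.sub_mul, Matrix.mul_sub, Matrix.sub_apply]
  by_cases hab : a = b
  · subst hab; simp
  · rw [Matrix.single_mul_apply_same, Matrix.mul_single_apply_same, Matrix.single_mul_apply_of_ne _ _ _ _ _ hab,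
      Matrix.mul_single_apply_of_ne _ _ _ _ _ (Ne.symm hab)]
    ring

/-- `[unitB a b, Y]_ab = i(Y_bb - Y_aa)`. -/
theorem comm_unitB_apply (Y : Matrix (Fin N) (Fin N) ℂ) (a b : Fin N) :
    (unitB a b * Y - Y * unitB a b) a b = Complex.I * (Y b b - Y a a) := by
  simp only [unitB, Matrix.smul_mul, Matrix.mul_smul, Matrix.add_mul, Matrix.mul_add, Matrix.sub_apply,
    Matrix.smul_apply, Matrix.add_apply, smul_eq_mul]
  by_cases hab : a = b
  · subst hab; simp
  · rw [Matrix.single_mul_apply_same, Matrix.mul_single_apply_same, Matrix.single_mul_apply_of_ne _ _ _ _ _ hab,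
      Matrix.mul_single_apply_of_ne _ _ _ _ _ (Ne.symm hab)]
    ring

/-- The scalar correction commutes: `[unitB' a b, Y] = [unitB a b, Y]`. -/
theorem comm_unitB' (Y : Matrix (Fin N) (Fin N) ℂ) (a b : Fin N) :
    unitB' a b * Y - Y * unitB' a b = unitB a b * Y - Y * unitB a b := by
  unfold unitB'
  split_ifs
  · simp only [Matrix.sub_mul, Matrix.mul_sub, Matrix.smul_mul, Matrix.mul_smul, Matrix.one_mul, Matrix.mul_one]
    abel
  · rw [sub_zero]

/-- ★ **Divergence freeness, antisymmetric units**: `½Re [unitA a b, Y]_ab = 0` for skew-Hermitian `Y`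
(the diagonal of `Y` is imaginary). [folklore] -/
theorem coefRe_comm_unitA {Y : Matrix (Fin N) (Fin N) ℂ} (hY : star Y = -Y) (a b : Fin N) :
    coefRe a b (unitA a b * Y - Y * unitA a b) = 0 := by
  rw [coefRe_apply, comm_unitA_apply]
  have ha := apply_eq_neg_conj_of_star_eq_neg hY a a
  have hb := apply_eq_neg_conj_of_star_eq_neg hY b b
  have ha' : (Y a a).re = 0 := by
    have := congrArg Complex.re ha; simp at this; linarith
  have hb' : (Y b b).re = 0 := by
    have := congrArg Complex.re hb; simp at this; linarith
  simp [ha', hb']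

/-- ★ **Divergence freeness, symmetric units**: `½Im [unitB a b, Y]_ab = 0` for skew-Hermitian `Y`. -/
theorem coefIm_comm_unitB {Y : Matrix (Fin N) (Fin N) ℂ} (hY : star Y = -Y) (a b : Fin N) :
    coefIm a b (unitB a b * Y - Y * unitB a b) = 0 := by
  rw [coefIm_apply, comm_unitB_apply]
  have ha := apply_eq_neg_conj_of_star_eq_neg hY a a
  have hb := apply_eq_neg_conj_of_star_eq_neg hY b b
  have ha' : (Y a a).re = 0 := by
    have := congrArg Complex.re ha; simp at this; linarith
  have hb' : (Y b b).re = 0 := by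
    have := congrArg Complex.re hb; simp at this; linarith
  simp [ha', hb']

/-- Divergence freeness for the traceless symmetric units. -/
theorem coefIm_comm_unitB' {Y : Matrix (Fin N) (Fin N) ℂ} (hY : star Y = -Y) (a b : Fin N) :
    coefIm a b (unitB' a b * Y - Y * unitB' a b) = 0 := by
  rw [comm_unitB', coefIm_comm_unitB hY]

/-- Conjugating a skew-Hermitian matrix by `M (·) Mᴴ` keeps it skew-Hermitian. -/
theorem star_conj_eq_neg {X M : Matrix (Fin N) (Fin N) ℂ} (hX : star X = -X) :
    star (M * X * star M) = -(M * X * star M) := by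
  rw [star_mul, star_mul, star_star, hX, neg_mul, mul_neg, mul_assoc]

end MatrixUnits

/-! ## The direction families -/

section Families

variable (N : ℕ)

/-- The `𝔲(N)` directions indexed by `Fin N × Fin N × Bool`: `(a, b, false) ↦ E_ab - E_ba`,
`(a, b, true) ↦ i(E_ab + E_ba)`. [folklore] -/
def uDir : Fin N × Fin N × Bool → UGenerator N
  | (a, b, false) => ⟨unitA a b, skewAdjoint.mem_iff.2 (star_unitA a b)⟩
  | (a, b, true) => ⟨unitB a b, skewAdjoint.mem_iff.2 (star_unitB a b)⟩

/-- The `𝔰𝔲(N)` directions: as `uDir` with the traceless diagonal correction. [folklore] -/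
def suDir : Fin N × Fin N × Bool → SuGenerator N
  | (a, b, false) => ⟨unitA a b, skewAdjoint.mem_iff.2 (star_unitA a b), trace_unitA a b⟩
  | (a, b, true) => ⟨unitB' a b, skewAdjoint.mem_iff.2 (star_unitB' a b), trace_unitB' a b⟩

/-- The coordinates: `(a, b, false) ↦ ½Re(·)_ab`, `(a, b, true) ↦ ½Im(·)_ab`. [folklore] -/
def unitCoef : Fin N × Fin N × Bool → (Matrix (Fin N) (Fin N) ℂ →ₗ[ℝ] ℝ)
  | (a, b, false) => coefRe a b
  | (a, b, true) => coefIm a b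

variable {N}

/-- The sum over the direction family is the double matrix-unit sum (`U(N)`). -/
theorem sum_unitCoef_smul_uDir (Y : Matrix (Fin N) (Fin N) ℂ) :
    ∑ j, unitCoef N j Y • ((uDir N j : UGenerator N) : Matrix (Fin N) (Fin N) ℂ) =
      ∑ a, ∑ b, (coefRe a b Y • unitA a b + coefIm a b Y • unitB a b) := by
  rw [Fintype.sum_prod_type]
  refine Finset.sum_congr rfl fun a _ => ?_
  rw [Fintype.sum_prod_type]
  refine Finset.sum_congr rfl fun b _ => ?_
  rw [Fintype.sum_bool, add_comm]
  rfl

/-- The sum over the direction family is the double matrix-unit sum (`SU(N)`). -/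
theorem sum_unitCoef_smul_suDir (Y : Matrix (Fin N) (Fin N) ℂ) :
    ∑ j, unitCoef N j Y • ((suDir N j : SuGenerator N) : Matrix (Fin N) (Fin N) ℂ) =
      ∑ a, ∑ b, (coefRe a b Y • unitA a b + coefIm a b Y • unitB' a b) := by
  rw [Fintype.sum_prod_type]
  refine Finset.sum_congr rfl fun a _ => ?_
  rw [Fintype.sum_prod_type]
  refine Finset.sum_congr rfl fun b _ => ?_
  rw [Fintype.sum_bool, add_comm]
  rfl

end Families

/-! ## `U(N)` and `SU(N)`: left rows ⇒ right rows -/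

section Unitary

open Literature.MathematicalPhysics.QuantumLattice
open Literature.MathematicalPhysics.QuantumFieldTheory (Edge GaugeConfig wilsonAction)

variable {ι : Type*} [DecidableEq ι] (N : ℕ)

/-- Unitarity of a `LatticeRep`: `ρ(g⁻¹) = ρ(g)ᴴ`. -/
theorem LatticeRepInv.rho_inv_eq_star {G : Type*} [Group G] [TopologicalSpace G] (r : LatticeRep G) (g : G) :
    r.ρ g⁻¹ = star (r.ρ g) := by
  have h1 : r.ρ g⁻¹ * r.ρ g = 1 := by rw [← map_mul, inv_mul_cancel, map_one]
  have h2 : star (r.ρ g) * r.ρ g = 1 := Matrix.mem_unitaryGroup_iff'.1 (r.mem_unitary g)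
  rw [← Matrix.inv_eq_left_inv h1, Matrix.inv_eq_left_inv h2]

/-- Conjugated skew-Hermitian generators are skew-Hermitian (unitary `ρ`). -/
theorem star_rho_conj_eq_neg {G : Type*} [Group G] [TopologicalSpace G] (r : LatticeRep G)
    {X : Matrix (Fin r.N) (Fin r.N) ℂ} (hX : star X = -X) (g : G) :
    star (r.ρ g * X * r.ρ g⁻¹) = -(r.ρ g * X * r.ρ g⁻¹) := by
  rw [LatticeRepInv.rho_inv_eq_star]
  exact star_conj_eq_neg hX

/-- Conjugation preserves the trace. -/
theorem trace_rho_conj {G : Type*} [Group G] [TopologicalSpace G] (r : LatticeRep G)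
    (X : Matrix (Fin r.N) (Fin r.N) ℂ) (g : G) : (r.ρ g * X * r.ρ g⁻¹).trace = X.trace := by
  rw [Matrix.trace_mul_cycle, ← map_mul, inv_mul_cancel, map_one, Matrix.one_mul]

/-- ★★★ **`U(N)`: the left loop equations imply the right loop equations.** For `U(N)`-valued link
variables on any index set of links, polynomial local actions `S i` and any `β`: a linear functional
satisfying the loop equations along all left shifts `U_i ↦ e^{tX} U_i`, `X ∈ 𝔲(N)`, satisfies them
along all right shifts `U_i ↦ U_i e^{tX}`. [folklore] -/
theorem IsSDFunctional.isRightSDFunctional_uN {S : ι → (ι → Matrix.unitaryGroup (Fin N) ℂ) → ℝ}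
    (hS : ∀ i, S i ∈ polyFunctions (ι := ι) (unitaryFundamentalLatticeRep N)) {β : ℝ}
    {φ : C(ι → Matrix.unitaryGroup (Fin N) ℂ, ℝ) →ₗ[ℝ] ℝ}
    (hφ : IsSDFunctional (unitaryFundamentalLatticeRep N) (uExp N) S β φ) :
    IsRightSDFunctional (unitaryFundamentalLatticeRep N) (uExp N) S β φ := by
  have hskew := fun (X : UGenerator N) (g : Matrix.unitaryGroup (Fin N) ℂ) =>
    star_rho_conj_eq_neg (unitaryFundamentalLatticeRep N) (X := (X : Matrix (Fin N) (Fin N) ℂ))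
      (skewAdjoint.mem_iff.1 X.2) g
  refine hφ.isRightSDFunctional (unitaryFundamentalLatticeRep N) (uDir N) (unitCoef N) (uExp_add N)
    (X := fun X : UGenerator N => (X : Matrix (Fin N) (Fin N) ℂ)) (rho_uExp N) ?_ ?_ ?_ hS
  · intro X g
    exact (skewAdjoint_decomp _ (hskew X g)).trans (sum_unitCoef_smul_uDir _).symm
  · rintro ⟨a, b, _ | _⟩ X g
    · exact coefRe_comm_unitA (hskew X g) a b
    · exact coefIm_comm_unitB (hskew X g) a b
  · rintro ⟨a, b, _ | _⟩
    · exact preservesPoly_re_entry (ι := ι) (unitaryFundamentalLatticeRep N) a b (1 / 2)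
    · exact preservesPoly_im_entry (ι := ι) (unitaryFundamentalLatticeRep N) a b (1 / 2)

/-- ★★★ **`SU(N)`: the left loop equations imply the right loop equations** (shifts `e^{tX}`,
`X ∈ 𝔰𝔲(N)`; traceless matrix units). [folklore] -/
theorem IsSDFunctional.isRightSDFunctional_suN {S : ι → (ι → Matrix.specialUnitaryGroup (Fin N) ℂ) → ℝ}
    (hS : ∀ i, S i ∈ polyFunctions (ι := ι) (fundamentalLatticeRep N)) {β : ℝ}
    {φ : C(ι → Matrix.specialUnitaryGroup (Fin N) ℂ, ℝ) →ₗ[ℝ] ℝ}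
    (hφ : IsSDFunctional (fundamentalLatticeRep N) (suExp N) S β φ) :
    IsRightSDFunctional (fundamentalLatticeRep N) (suExp N) S β φ := by
  have hskew := fun (X : SuGenerator N) (g : Matrix.specialUnitaryGroup (Fin N) ℂ) =>
    star_rho_conj_eq_neg (fundamentalLatticeRep N) (X := (X : Matrix (Fin N) (Fin N) ℂ))
      (skewAdjoint.mem_iff.1 X.2.1) g
  have htr := fun (X : SuGenerator N) (g : Matrix.specialUnitaryGroup (Fin N) ℂ) =>
    (trace_rho_conj (fundamentalLatticeRep N) (X : Matrix (Fin N) (Fin N) ℂ) g).trans X.2.2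
  refine hφ.isRightSDFunctional (fundamentalLatticeRep N) (suDir N) (unitCoef N) (suExp_add N)
    (X := fun X : SuGenerator N => (X : Matrix (Fin N) (Fin N) ℂ)) (rho_suExp N) ?_ ?_ ?_ hS
  · intro X g
    exact (skewAdjoint_traceless_decomp _ (hskew X g) (htr X g)).trans (sum_unitCoef_smul_suDir _).symm
  · rintro ⟨a, b, _ | _⟩ X g
    · exact coefRe_comm_unitA (hskew X g) a b
    · exact coefIm_comm_unitB' (hskew X g) a b
  · rintro ⟨a, b, _ | _⟩
    · exact preservesPoly_re_entry (ι := ι) (fundamentalLatticeRep N) a b (1 / 2)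
    · exact preservesPoly_im_entry (ι := ι) (fundamentalLatticeRep N) a b (1 / 2)

variable {d L : ℕ} [NeZero L]

/-- ★★★ **Torus `U(N)` Wilson theory, any `β`, `d`, `L`: every Schwinger–Dyson functional (left
rows) satisfies the right rows.** [folklore] -/
theorem isRightSDFunctional_wilson_uN (β : ℝ) {φ : C(GaugeConfig d L (Matrix.unitaryGroup (Fin N) ℂ), ℝ) →ₗ[ℝ] ℝ}
    (hφ : IsSDFunctional (unitaryFundamentalLatticeRep N) (uExp N)
      (fun _ : Edge d L => wilsonAction (unitaryFundamentalRep (Fin N) ℂ)) β φ) :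
    IsRightSDFunctional (unitaryFundamentalLatticeRep N) (uExp N)
      (fun _ : Edge d L => wilsonAction (unitaryFundamentalRep (Fin N) ℂ)) β φ :=
  hφ.isRightSDFunctional_uN N (fun _ => wilsonAction_mem_polyFunctions (unitaryFundamentalLatticeRep N))

/-- ★★★ **Torus `SU(N)` Wilson theory, any `β`, `d`, `L`: every Schwinger–Dyson functional satisfies
the right rows.** [folklore] -/
theorem isRightSDFunctional_wilson_suN (β : ℝ)
    {φ : C(GaugeConfig d L (Matrix.specialUnitaryGroup (Fin N) ℂ), ℝ) →ₗ[ℝ] ℝ}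
    (hφ : IsSDFunctional (fundamentalLatticeRep N) (suExp N)
      (fun _ : Edge d L => wilsonAction (fundamentalRep (Fin N))) β φ) :
    IsRightSDFunctional (fundamentalLatticeRep N) (suExp N)
      (fun _ : Edge d L => wilsonAction (fundamentalRep (Fin N))) β φ :=
  hφ.isRightSDFunctional_suN N (fun _ => wilsonAction_mem_polyFunctions (fundamentalLatticeRep N))

end Unitary

end Summit.QuantumFields.GaugeBoot

end
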